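import Mathlib

/-!
# Nagata twist for hypersurface frames, II: substitution identities and derivatives

Helper file for `stub_dfrTwist` (crux `DefectlessFramesR`, line `Sketch`); its registered sub-goal is
`stub_dfrTwistSubst` (transport of a principal kernel along the twist).

The twist `T_c : X_j ↦ X_j + c • ν(X_n)^{N j}` (`j < n`), `X_n ↦ X_n` of `k[X_0, …, X_n]`
(written out as `MvPolynomial.aeval (Fin.snoc … (X (Fin.last n)))`), its inverse `T_{-c}`, its
compatibility with evaluation, the transport of a principal kernel along it, the identification of
`k[X_0..X_n]` with `A[X]` (`A = k[X_0..X_{n-1}]`, last variable singled out) and the resulting formulas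
for evaluations; the chain rule for `d/dX` of a twisted evaluation, the non-vanishing of the `X`-derivative
of the twist for Nagata exponents, and the fact that an irreducible polynomial over a perfect field has a
non-vanishing partial derivative; two elementary facts on perturbed evaluations and root multiplicities.
-/

namespace Summit.ResolutionOfSingularities.ResolutionOfSingularities.Theorems

open MvPolynomial Polynomial

/-- Chain rule: `d/dX g(v_1(X), …, v_m(X)) = ∑ᵢ (∂ᵢ g)(v(X)) · v_i'(X)`. [folklore] -/
theorem dfrTwist_derivative_aeval {R S ι : Type*} [CommRing R] [CommRing S] [Algebra R S]
    [Fintype ι] (v : ι → S[X]) (g : MvPolynomial ι R) :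
    derivative (MvPolynomial.aeval v g)
      = ∑ i, MvPolynomial.aeval v (pderiv i g) * derivative (v i) := by
  classical
  induction g using MvPolynomial.induction_on with
  | C a => simp [Polynomial.algebraMap_apply]
  | add p q hp hq => simp only [map_add, hp, hq, add_mul, Finset.sum_add_distrib]
  | mul_X p i hp =>
    have h2 : ∀ j, MvPolynomial.aeval v (pderiv j (p * X i)) * derivative (v j)
        = MvPolynomial.aeval v (pderiv j p) * derivative (v j) * v i
          + (if j = i then MvPolynomial.aeval v p * derivative (v i) else 0) := by
      intro j
      rw [pderiv_mul, pderiv_X, map_add, map_mul, map_mul, MvPolynomial.aeval_X]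
      by_cases hji : j = i
      · subst hji
        simp only [Pi.single_eq_same, map_one, mul_one, if_true]
        ring
      · rw [Pi.single_eq_of_ne' hji, map_zero, if_neg hji]
        ring
    rw [map_mul, MvPolynomial.aeval_X, derivative_mul, hp, Finset.sum_mul]
    simp only [h2, Finset.sum_add_distrib, Finset.sum_ite_eq', Finset.mem_univ, if_true]

/-- An irreducible polynomial over a perfect field of characteristic `p` has some non-vanishing
partial derivative (otherwise it would be a `p`-th power). [folklore] -/
theorem dfrTwist_exists_pderiv_ne_zero {k σ : Type*} [Field k] (p : ℕ) (hp : p.Prime) [CharP k p]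
    [PerfectField k] (f : MvPolynomial σ k) (hf : Irreducible f) : ∃ i, pderiv i f ≠ 0 := by
  classical
  haveI : ExpChar k p := ExpChar.prime hp
  haveI : Fact p.Prime := ⟨hp⟩
  by_contra hall
  push Not at hall
  -- every exponent in the support of `f` is divisible by `p`
  have hdvd : ∀ α ∈ f.support, ∀ i, p ∣ α i := by
    intro α hα i
    by_cases hαi : α i = 0
    · simp [hαi]
    have hc := coeff_pderiv (i := i) f (α - Finsupp.single i 1)
    rw [hall i, MvPolynomial.coeff_zero, tsub_add_cancel_of_le
      (Finsupp.single_le_iff.mpr (Nat.one_le_iff_ne_zero.mpr hαi))] at hc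
    have hα' : coeff α f ≠ 0 := mem_support_iff.mp hα
    have hcast : ((α i : ℕ) : k) = 0 := by
      have h1 : (((α - Finsupp.single i 1 : σ →₀ ℕ) i : ℕ) : k) + 1 = (α i : k) := by
        rw [Finsupp.tsub_apply, Finsupp.single_eq_same, ← Nat.cast_succ, Nat.succ_eq_add_one,
          Nat.sub_add_cancel (Nat.one_le_iff_ne_zero.mpr hαi)]
      rw [← h1]
      exact (mul_eq_zero.mp hc.symm).resolve_left hα'
    exact (CharP.cast_eq_zero_iff k p _).mp hcast
  -- hence `f` is a `p`-th power
  choose! β hβ using fun α (hα : α ∈ f.support) =>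
    (show ∃ β : σ →₀ ℕ, α = p • β from
      ⟨α.mapRange (· / p) (by simp), Finsupp.ext fun i => by
        simp [Nat.mul_div_cancel' (hdvd α hα i)]⟩)
  set g : MvPolynomial σ k := ∑ α ∈ f.support, monomial (β α) ((frobeniusEquiv k p).symm (coeff α f))
    with hg
  have hgp : g ^ p = f := by
    rw [hg, sum_pow_char]
    conv_rhs => rw [← support_sum_monomial_coeff f]
    refine Finset.sum_congr rfl fun α hα => ?_
    rw [MvPolynomial.monomial_pow, frobeniusEquiv_symm_pow_p, ← hβ α hα]
  exact not_irreducible_pow hp.ne_one (hgp ▸ hf : Irreducible (g ^ p))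

variable {k : Type*} [Field k] {n : ℕ}

/-- The `X`-derivative of the Nagata twist `f(X_0 - ν(X)^{N_0}, …, X_{n-1} - ν(X)^{N_{n-1}}, X)`.
[folklore] -/
theorem dfrTwist_derivative_twist (ν : k[X]) (N : Fin n → ℕ) (f : MvPolynomial (Fin (n + 1)) k) :
    derivative (MvPolynomial.aeval (Fin.snoc (fun j => Polynomial.C (X j) -
        (ν.map MvPolynomial.C) ^ N j) Polynomial.X) f)
      = MvPolynomial.aeval (Fin.snoc (fun j => Polynomial.C (X j) -
          (ν.map MvPolynomial.C) ^ N j) Polynomial.X) (pderiv (Fin.last n) f)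
        - ∑ j : Fin n, MvPolynomial.aeval (Fin.snoc (fun j => Polynomial.C (X j) -
            (ν.map MvPolynomial.C) ^ N j) Polynomial.X) (pderiv (Fin.castSucc j) f) *
          (Polynomial.C ((N j : ℕ) : MvPolynomial (Fin n) k) * (ν.map MvPolynomial.C) ^ (N j - 1) *
            derivative (ν.map MvPolynomial.C)) := by
  rw [dfrTwist_derivative_aeval, Fin.sum_univ_castSucc]
  simp only [Fin.snoc_castSucc, Fin.snoc_last, derivative_X, mul_one, derivative_sub, derivative_C,
    zero_sub, derivative_pow, mul_neg, Finset.sum_neg_distrib]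
  abel

/-- Non-vanishing of the `X`-derivative of the Nagata twist, for exponents `N j ≡ [t = some j]`
modulo the characteristic: in case `t = none` it reduces to the twist of `∂f/∂X_n ≠ 0`, in case
`t = some j₀` (where `∂f/∂X_n = 0`) to `-(∂f/∂X_{j₀})^{tw} · ν^{N_{j₀}-1} ν' ≠ 0`. [folklore] -/
theorem dfrTwist_derivative_twist_ne_zero (p : ℕ) [CharP k p] (ν : k[X]) (hν0 : ν ≠ 0)
    (hν' : derivative ν ≠ 0) (N : Fin n → ℕ) (t : Option (Fin n))
    (hNcast : ∀ j, ((N j : ℕ) : k) = if t = some j then 1 else 0)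
    (f : MvPolynomial (Fin (n + 1)) k)
    (hΦ : Function.Injective (MvPolynomial.aeval (R := k) (Fin.snoc (fun j => Polynomial.C (X j) -
        (ν.map MvPolynomial.C) ^ N j) Polynomial.X) :
          MvPolynomial (Fin (n + 1)) k → (MvPolynomial (Fin n) k)[X]))
    (hnone : t = none → pderiv (Fin.last n) f ≠ 0)
    (hsome : ∀ j0, t = some j0 → pderiv (Fin.last n) f = 0 ∧ pderiv (Fin.castSucc j0) f ≠ 0) :
    derivative (MvPolynomial.aeval (Fin.snoc (fun j => Polynomial.C (X j) -
        (ν.map MvPolynomial.C) ^ N j) Polynomial.X) f) ≠ 0 := by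
  set Φ : MvPolynomial (Fin (n + 1)) k →ₐ[k] (MvPolynomial (Fin n) k)[X] :=
    MvPolynomial.aeval (Fin.snoc (fun j => Polynomial.C (X j) -
      (ν.map MvPolynomial.C) ^ N j) Polynomial.X) with hΦdef
  have hcastA : ∀ j, ((N j : ℕ) : MvPolynomial (Fin n) k) = if t = some j then 1 else 0 := fun j => by
    rw [← map_natCast (MvPolynomial.C : k →+* MvPolynomial (Fin n) k), hNcast]
    split_ifs <;> simp
  have hνA : ν.map (MvPolynomial.C : k →+* MvPolynomial (Fin n) k) ≠ 0 :=
    (Polynomial.map_ne_zero_iff (MvPolynomial.C_injective _ _)).mpr hν0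
  have hνA' : derivative (ν.map (MvPolynomial.C : k →+* MvPolynomial (Fin n) k)) ≠ 0 := by
    rw [derivative_map]
    exact (Polynomial.map_ne_zero_iff (MvPolynomial.C_injective _ _)).mpr hν'
  have hΦ0 : ∀ g, Φ g = 0 ↔ g = 0 := fun g => map_eq_zero_iff Φ hΦ
  rw [dfrTwist_derivative_twist]
  cases ht : t with
  | none =>
    have hzero : ∀ j, ((N j : ℕ) : MvPolynomial (Fin n) k) = 0 := fun j => by
      rw [hcastA j, ht]; simp
    simp only [hzero, map_zero, zero_mul, mul_zero, Finset.sum_const_zero, sub_zero]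
    rw [Ne, hΦ0]
    exact hnone ht
  | some j0 =>
    obtain ⟨hlast, hj0⟩ := hsome j0 ht
    rw [hlast, map_zero, zero_sub, neg_ne_zero, Finset.sum_eq_single j0]
    · rw [hcastA j0, ht, if_pos rfl, map_one, one_mul]
      exact mul_ne_zero (fun h => hj0 ((hΦ0 _).mp h)) (mul_ne_zero (pow_ne_zero _ hνA) hνA')
    · intro j _ hj
      rw [hcastA j, ht, if_neg (fun h => hj (Option.some_injective _ h).symm), map_zero, zero_mul,
        zero_mul, mul_zero]
    · intro h; exact absurd (Finset.mem_univ j0) h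

variable {k : Type*} [Field k] {n : ℕ}

/-- Evaluating a twisted polynomial: `(T_c g)(a, b) = g(a + c ν(b)^N, b)`. [folklore] -/
theorem dfrTwist_eval₂_twist {S : Type*} [CommRing S] (φ : k →+* S) (ν : k[X]) (N : Fin n → ℕ)
    (c : k) (a : Fin n → S) (b : S) (g : MvPolynomial (Fin (n + 1)) k) :
    MvPolynomial.eval₂ φ (Fin.snoc a b) (MvPolynomial.aeval (Fin.snoc (fun j => (MvPolynomial.X (Fin.castSucc j) : MvPolynomial (Fin (n + 1)) k) +
        c • (Polynomial.aeval (MvPolynomial.X (Fin.last n)) ν) ^ N j) (MvPolynomial.X (Fin.last n))) g)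
      = MvPolynomial.eval₂ φ (Fin.snoc (fun j => a j + φ c * (ν.eval₂ φ b) ^ N j) b) g := by
  change eval₂Hom φ (Fin.snoc a b) (bind₁ _ g) = eval₂Hom φ _ g
  rw [eval₂Hom_bind₁]
  congr 2
  funext i
  refine Fin.lastCases ?_ (fun j => ?_) i
  · simp
  · simp only [Fin.snoc_castSucc, map_add, map_pow, eval₂Hom_X', MvPolynomial.smul_eq_C_mul, map_mul,
      eval₂Hom_C, Polynomial.aeval_def, Polynomial.hom_eval₂, MvPolynomial.algebraMap_eq,
      eval₂Hom_comp_C, Fin.snoc_last]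

/-- `T_c ∘ T_{-c} = id`. [folklore] -/
theorem dfrTwist_twist_comp_neg (ν : k[X]) (N : Fin n → ℕ) (c : k) :
    (MvPolynomial.aeval (Fin.snoc (fun j => (MvPolynomial.X (Fin.castSucc j) : MvPolynomial (Fin (n + 1)) k) +
        c • (Polynomial.aeval (MvPolynomial.X (Fin.last n)) ν) ^ N j) (MvPolynomial.X (Fin.last n))) :
          MvPolynomial (Fin (n + 1)) k →ₐ[k] MvPolynomial (Fin (n + 1)) k).comp
      (MvPolynomial.aeval (Fin.snoc (fun j => (MvPolynomial.X (Fin.castSucc j) : MvPolynomial (Fin (n + 1)) k) +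
        (-c) • (Polynomial.aeval (MvPolynomial.X (Fin.last n)) ν) ^ N j) (MvPolynomial.X (Fin.last n))))
      = AlgHom.id k _ := by
  rw [comp_aeval, ← MvPolynomial.aeval_X_left]
  congr 1
  funext i
  refine Fin.lastCases ?_ (fun j => ?_) i
  · simp
  · simp only [Fin.snoc_castSucc, map_add, map_neg, map_smul, map_pow, ← Polynomial.aeval_algHom_apply,
      MvPolynomial.aeval_X, Fin.snoc_last, neg_smul, add_neg_cancel_right]

/-- `T_c (T_{-c} g) = g`. [folklore] -/
theorem dfrTwist_twist_twist_neg (ν : k[X]) (N : Fin n → ℕ) (c : k) (g : MvPolynomial (Fin (n + 1)) k) :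
    MvPolynomial.aeval (Fin.snoc (fun j => (MvPolynomial.X (Fin.castSucc j) : MvPolynomial (Fin (n + 1)) k) +
        c • (Polynomial.aeval (MvPolynomial.X (Fin.last n)) ν) ^ N j) (MvPolynomial.X (Fin.last n)))
      (MvPolynomial.aeval (Fin.snoc (fun j => (MvPolynomial.X (Fin.castSucc j) : MvPolynomial (Fin (n + 1)) k) +
        (-c) • (Polynomial.aeval (MvPolynomial.X (Fin.last n)) ν) ^ N j) (MvPolynomial.X (Fin.last n))) g) = g := by
  have := AlgHom.congr_fun (dfrTwist_twist_comp_neg ν N c) g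
  simpa only [AlgHom.comp_apply, AlgHom.id_apply] using this

/-- Transport of a principal kernel along the twist: if `ker (g ↦ g(a, b)) = (f)` then
`ker (g ↦ g(a + ν(b)^N, b)) = (T_{-1} f)`. [folklore] -/
theorem dfrTwist_ker_twist {K : Type*} [Field K] [Algebra k K] (ν : k[X]) (N : Fin n → ℕ)
    (a : Fin n → K) (b : K) (f : MvPolynomial (Fin (n + 1)) k)
    (hker : Ideal.span {f} = RingHom.ker (MvPolynomial.aeval (Fin.snoc a b) :
      MvPolynomial (Fin (n + 1)) k →ₐ[k] K)) :
    Ideal.span {MvPolynomial.aeval (Fin.snoc (fun j => (MvPolynomial.X (Fin.castSucc j) : MvPolynomial (Fin (n + 1)) k) +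
        (-1 : k) • (Polynomial.aeval (MvPolynomial.X (Fin.last n)) ν) ^ N j) (MvPolynomial.X (Fin.last n))) f}
      = RingHom.ker (MvPolynomial.aeval (Fin.snoc (fun j => a j + (Polynomial.aeval b ν) ^ N j) b) :
          MvPolynomial (Fin (n + 1)) k →ₐ[k] K) := by
  have hev : ∀ g : MvPolynomial (Fin (n + 1)) k,
      MvPolynomial.aeval (Fin.snoc (fun j => a j + (Polynomial.aeval b ν) ^ N j) b) g
        = MvPolynomial.aeval (Fin.snoc a b) (MvPolynomial.aeval (Fin.snoc (fun j => (MvPolynomial.X (Fin.castSucc j) : MvPolynomial (Fin (n + 1)) k) +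
            (1 : k) • (Polynomial.aeval (MvPolynomial.X (Fin.last n)) ν) ^ N j) (MvPolynomial.X (Fin.last n))) g) := by
    intro g
    rw [MvPolynomial.aeval_def, MvPolynomial.aeval_def, ← coe_eval₂Hom, ← coe_eval₂Hom,
      coe_eval₂Hom, coe_eval₂Hom, dfrTwist_eval₂_twist]
    simp [Polynomial.aeval_def]
  ext g
  rw [RingHom.mem_ker, hev g, ← RingHom.mem_ker, ← hker, Ideal.mem_span_singleton,
    Ideal.mem_span_singleton]
  constructor
  · rintro ⟨q, hq⟩
    refine ⟨MvPolynomial.aeval (Fin.snoc (fun j => (MvPolynomial.X (Fin.castSucc j) : MvPolynomial (Fin (n + 1)) k) +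
        (1 : k) • (Polynomial.aeval (MvPolynomial.X (Fin.last n)) ν) ^ N j) (MvPolynomial.X (Fin.last n))) q, ?_⟩
    rw [hq, map_mul, dfrTwist_twist_twist_neg]
  · rintro ⟨q, hq⟩
    refine ⟨MvPolynomial.aeval (Fin.snoc (fun j => (MvPolynomial.X (Fin.castSucc j) : MvPolynomial (Fin (n + 1)) k) +
        (-1 : k) • (Polynomial.aeval (MvPolynomial.X (Fin.last n)) ν) ^ N j) (MvPolynomial.X (Fin.last n))) q, ?_⟩
    have := congrArg (MvPolynomial.aeval (Fin.snoc (fun j => (MvPolynomial.X (Fin.castSucc j) : MvPolynomial (Fin (n + 1)) k) +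
        (-1 : k) • (Polynomial.aeval (MvPolynomial.X (Fin.last n)) ν) ^ N j) (MvPolynomial.X (Fin.last n)))) hq
    rw [map_mul] at this
    rw [← this]
    have h2 := dfrTwist_twist_twist_neg ν N (-1) g
    rw [neg_neg] at h2
    exact h2.symm

/-- Singling out the last variable, `k[X_0..X_n] ≃ₐ[k] A[X]`: values on the generators. [folklore] -/
theorem dfrTwist_fin_X_castSucc (j : Fin n) :
    ((MvPolynomial.renameEquiv k finSuccEquivLast).trans (MvPolynomial.optionEquivLeft k (Fin n)))
      (MvPolynomial.X (Fin.castSucc j) : MvPolynomial (Fin (n + 1)) k) = Polynomial.C (MvPolynomial.X j) := by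
  simp [finSuccEquivLast_castSucc]

/-- Singling out the last variable: the last variable goes to `X`. [folklore] -/
theorem dfrTwist_fin_X_last :
    ((MvPolynomial.renameEquiv k finSuccEquivLast).trans (MvPolynomial.optionEquivLeft k (Fin n)))
      (MvPolynomial.X (Fin.last n) : MvPolynomial (Fin (n + 1)) k) = Polynomial.X := by
  simp [finSuccEquivLast_last]

/-- Singling out the last variable: constants. [folklore] -/
theorem dfrTwist_fin_C (r : k) :
    ((MvPolynomial.renameEquiv k finSuccEquivLast).trans (MvPolynomial.optionEquivLeft k (Fin n)))
      (MvPolynomial.C r : MvPolynomial (Fin (n + 1)) k) = Polynomial.C (MvPolynomial.C r) := by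
  simp

/-- `ν(X) ∈ A[X]` as an `aeval`. [folklore] -/
theorem dfrTwist_aeval_X_eq_map (ν : k[X]) :
    Polynomial.aeval (Polynomial.X : (MvPolynomial (Fin n) k)[X]) ν = ν.map MvPolynomial.C := by
  rw [Polynomial.aeval_def,
    show algebraMap k (MvPolynomial (Fin n) k)[X] = Polynomial.C.comp MvPolynomial.C from
      RingHom.ext fun r => by simp [Polynomial.algebraMap_apply]]
  rfl

/-- Singling out the last variable after the twist `T_{-1}` is the twisted evaluation
`X_j ↦ C (X j) - ν(X)^{N j}`, `X_n ↦ X`. [folklore] -/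
theorem dfrTwist_fin_twist (ν : k[X]) (N : Fin n → ℕ) (g : MvPolynomial (Fin (n + 1)) k) :
    ((MvPolynomial.renameEquiv k finSuccEquivLast).trans (MvPolynomial.optionEquivLeft k (Fin n)))
      (MvPolynomial.aeval (Fin.snoc (fun j => (MvPolynomial.X (Fin.castSucc j) : MvPolynomial (Fin (n + 1)) k) +
        (-1 : k) • (Polynomial.aeval (MvPolynomial.X (Fin.last n)) ν) ^ N j) (MvPolynomial.X (Fin.last n))) g)
      = MvPolynomial.aeval (Fin.snoc (fun j => Polynomial.C (MvPolynomial.X j) -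
          (ν.map MvPolynomial.C) ^ N j) Polynomial.X) g := by
  induction g using MvPolynomial.induction_on with
  | C a =>
    rw [MvPolynomial.algHom_C, MvPolynomial.algHom_C, Polynomial.algebraMap_apply, MvPolynomial.algebraMap_eq,
      MvPolynomial.algebraMap_eq, dfrTwist_fin_C]
  | add p q hp hq => rw [map_add, map_add, map_add, hp, hq]
  | mul_X q i hq =>
    rw [map_mul, map_mul, map_mul, hq, MvPolynomial.aeval_X, MvPolynomial.aeval_X]
    congr 1
    refine Fin.lastCases ?_ (fun j => ?_) i
    · simp [finSuccEquivLast_last]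
    · rw [Fin.snoc_castSucc, Fin.snoc_castSucc, map_add, neg_one_smul, map_neg, map_pow,
        ← Polynomial.aeval_algHom_apply, dfrTwist_fin_X_castSucc, dfrTwist_fin_X_last,
        dfrTwist_aeval_X_eq_map, sub_eq_add_neg]

/-- Evaluation after singling out the last variable: `(P g)(a)(b) = g(a, b)`. [folklore] -/
theorem dfrTwist_eval₂_fin {S : Type*} [CommRing S] (φ : k →+* S) (a : Fin n → S) (b : S)
    (g : MvPolynomial (Fin (n + 1)) k) :
    Polynomial.eval₂ (MvPolynomial.eval₂Hom φ a) b
      (((MvPolynomial.renameEquiv k finSuccEquivLast).trans (MvPolynomial.optionEquivLeft k (Fin n))) g)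
      = MvPolynomial.eval₂ φ (Fin.snoc a b) g := by
  set P := (MvPolynomial.renameEquiv k finSuccEquivLast).trans (MvPolynomial.optionEquivLeft k (Fin n))
    with hP
  have : (Polynomial.eval₂RingHom (MvPolynomial.eval₂Hom φ a) b).comp (P : MvPolynomial (Fin (n + 1)) k →+* _)
      = MvPolynomial.eval₂Hom φ (Fin.snoc a b) := by
    refine MvPolynomial.ringHom_ext (fun r => ?_) (fun i => ?_)
    · simp [hP]
    · refine Fin.lastCases ?_ (fun j => ?_) i
      · simp [hP, finSuccEquivLast_last]
      · simp [hP, finSuccEquivLast_castSucc]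
  exact RingHom.congr_fun this g

/-- Singling out the last variable sends polynomials in the first `n` variables to constants.
[folklore] -/
theorem dfrTwist_fin_rename_castSucc (g : MvPolynomial (Fin n) k) :
    ((MvPolynomial.renameEquiv k finSuccEquivLast).trans (MvPolynomial.optionEquivLeft k (Fin n)))
      (MvPolynomial.rename Fin.castSucc g) = Polynomial.C g := by
  set P := (MvPolynomial.renameEquiv k finSuccEquivLast).trans (MvPolynomial.optionEquivLeft k (Fin n))
    with hP
  have : (P : MvPolynomial (Fin (n + 1)) k →+* _).comp
      (MvPolynomial.rename Fin.castSucc : MvPolynomial (Fin n) k →ₐ[k] MvPolynomial (Fin (n + 1)) k).toRingHom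
        = Polynomial.C := by
    refine MvPolynomial.ringHom_ext (fun r => ?_) (fun j => ?_)
    · simp [hP]
    · simp [hP, finSuccEquivLast_castSucc]
  exact RingHom.congr_fun this g

/-- The axis polynomial `g(w̄, X) ∈ κ[X]` is the image of `P g ∈ A[X]` under `A → κ`,
`X_j ↦ w̄_j`. [folklore] -/
theorem dfrTwist_axis_eq_map {κ : Type*} [CommRing κ] (ρ : k →+* κ) (w : Fin n → κ)
    (g : MvPolynomial (Fin (n + 1)) k) :
    MvPolynomial.eval₂ (Polynomial.C.comp ρ) (Fin.snoc (fun j => Polynomial.C (w j)) Polynomial.X) g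
      = (((MvPolynomial.renameEquiv k finSuccEquivLast).trans (MvPolynomial.optionEquivLeft k (Fin n))) g).map
          (MvPolynomial.eval₂Hom ρ w) := by
  rw [← dfrTwist_eval₂_fin (Polynomial.C.comp ρ) (fun j => Polynomial.C (w j)) Polynomial.X g]
  have : MvPolynomial.eval₂Hom (Polynomial.C.comp ρ) (fun j => Polynomial.C (w j))
      = Polynomial.C.comp (MvPolynomial.eval₂Hom ρ w) :=
    MvPolynomial.ringHom_ext (fun r => by simp) (fun j => by simp)
  rw [this]
  rfl

/-- Perturbing the point of evaluation inside an ideal perturbs the value inside the ideal.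
[folklore] -/
theorem dfrTwist_eval₂_sub_eval₂_mem {R S σ : Type*} [CommRing R] [CommRing S] (φ : R →+* S)
    (u v : σ → S) (I : Ideal S) (h : ∀ i, u i - v i ∈ I) (g : MvPolynomial σ R) :
    MvPolynomial.eval₂ φ u g - MvPolynomial.eval₂ φ v g ∈ I := by
  rw [← Ideal.Quotient.eq, MvPolynomial.hom_eval₂, MvPolynomial.hom_eval₂]
  congr 1
  funext i
  exact (Ideal.Quotient.eq).mpr (h i)

/-- If `Q ≠ 0` and `Q' ≡ Q` modulo `(X - a)^(s+1)`, `s` the multiplicity of `a` in `Q`, then `Q' ≠ 0`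
and the multiplicity of `a` in `Q'` is at most `s`. [folklore] -/
theorem dfrTwist_rootMultiplicity_le_of_dvd_sub {κ : Type*} [CommRing κ] [IsDomain κ] (a : κ)
    (Q Q' : κ[X]) (hQ : Q ≠ 0)
    (h : (Polynomial.X - Polynomial.C a) ^ (Q.rootMultiplicity a + 1) ∣ Q' - Q) :
    Q' ≠ 0 ∧ Q'.rootMultiplicity a ≤ Q.rootMultiplicity a := by
  have hnd : ¬ (Polynomial.X - Polynomial.C a) ^ (Q.rootMultiplicity a + 1) ∣ Q :=
    (Polynomial.rootMultiplicity_le_iff hQ a _).mp le_rfl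
  have hQ' : Q' ≠ 0 := by
    rintro rfl
    rw [zero_sub, dvd_neg] at h
    exact hnd h
  refine ⟨hQ', (Polynomial.rootMultiplicity_le_iff hQ' a _).mpr fun h' => hnd ?_⟩
  have := dvd_sub h' h
  rwa [sub_sub_cancel] at this

/-- Registered sub-goal of `stub_dfrTwist`: **transport of a principal kernel along the twist**. If the
kernel of `g ↦ g(a, b)` is generated by `f`, then the kernel of `g ↦ g(a + ν(b)^N, b)` is generated by the
twisted polynomial `f(X - ν(X_n)^N, X_n)`. [folklore] -/
theorem stub_dfrTwistSubst : ∀ (k K : Type) [Field k] [Field K] [Algebra k K] (n : ℕ) (ν : Polynomial k) (N : Fin n → ℕ) (a : Fin n → K) (b : K) (f : MvPolynomial (Fin (n + 1)) k), Ideal.span {f} = RingHom.ker (MvPolynomial.aeval (Fin.snoc a b) : MvPolynomial (Fin (n + 1)) k →ₐ[k] K) → Ideal.span {MvPolynomial.aeval (Fin.snoc (fun j => (MvPolynomial.X (Fin.castSucc j) : MvPolynomial (Fin (n + 1)) k) + (-1 : k) • (Polynomial.aeval (MvPolynomial.X (Fin.last n)) ν) ^ N j) (MvPolynomial.X (Fin.last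 n))) f} = RingHom.ker (MvPolynomial.aeval (Fin.snoc (fun j => a j + (Polynomial.aeval b ν) ^ N j) b) : MvPolynomial (Fin (n + 1)) k →ₐ[k] K) := by
  intro k K _ _ _ n ν N a b f h
  exact dfrTwist_ker_twist ν N a b f h

end Summit.ResolutionOfSingularities.ResolutionOfSingularities.Theorems
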